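import Summits.KontsevichZagierPeriods.KontsevichZagierPeriods.Theorems.LiouvilleUnfoldingAyoubPiLocalKernelNilCut
import Summits.KontsevichZagierPeriods.KontsevichZagierPeriods.Theorems.VietaFibreKernelFormStubBoundedDecomposition
import Literature.NumberTheory.Transcendental.KZVolumeConjectureProofs
import Literature.NumberTheory.Transcendental.KZSemiCanonicalReductionProofs
import Literature.NumberTheory.Transcendental.KZCubicalCalculus
import Literature.NumberTheory.Transcendental.KZKernelConjectureForms

/-!
# Item stmt-KontsevichZagierPeriods-0541, line `SketchIdeator2`: the volume form of the crux
# (body trichotomy of the formal period ring)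

Support file (`--supports` stmt-KontsevichZagierPeriods-0541, registered stub
`ayoubPiLocalKernel_iff_volumeForm`).  Write `P := KZ.FormalPeriodRing`, `ϖ := ⟦[π]⟧`, and call a class
`x : P` a *body class* if `x = ⟦∫_K 1⟧` for a compact `ℚ`-semialgebraic `K` of non-empty interior
(a "compact volume form", the normal form of Viu-Sos / Cresson–Viu-Sos).  Inside the calculus, with no
transcendence input, we prove:

* `exists_body_eq_of_evalP_pos`, `evalP_pos_iff_exists_body`: **a formal period has positive value iff it
  is a body class** (Viu-Sos' semi-canonical reduction read in `P`: bounded decomposition + packing);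
* `evalP_eq_zero_iff_not_body`: hence **`ker evalP` is described without real numbers**: `x` has value `0`
  iff neither `x` nor `−x` is a body class; equivalently (`evalP_eq_zero_iff_forall_nat`) iff `1 + n x` and
  `1 − n x` are body classes for every `n : ℕ` (the value-kernel = the infinitesimals of the body order);
* `exists_body_sub_body`: every class is a difference of two body classes of one dimension;
* `ayoubPiLocalKernel_iff_volumeForm` (registered): **the crux is the `[π]`-LOCAL VOLUME CONJECTURE** —
  two compact bodies of equal volume become move-equivalent after multiplication by a power of the disc —
  the localised analogue of Cresson–Viu-Sos' reformulation of Conjecture 1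
  (`KZ.kzPeriodConjecture'_iff_volumeConjectureCompact_holds`);
* `ayoubPiLocalKernel_iff_trichotomy`: **the crux says `P = B ∪ −B ∪ Tors_ϖ`** — every formal period is a
  body class, or minus one, or `ϖ`-power torsion — while the summit says `P = B ∪ −B ∪ {0}`
  (`summit_iff_body_trichotomy`); the transcendence stub (N) of the line reads the same with "`ϖ`-locally
  nilpotent" (`nilLocalKernel_iff_volumeForm`);
* `not_ayoubPiLocalKernel_iff_exists_bodies`: so a refutation of item 0541 is exactly a pair of compact
  bodies of equal volume that stay move-inequivalent after every disc thickening (complementing the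
  kill-shape file `Theorems/AyoubPiLocalKernel/Negative/KillShape.lean`: the hypothesis side of a kill is
  now `eval`-free as well).

References: J. Viu-Sos, IJNT 17 (2021), Thm. 1.1; J. Cresson, J. Viu-Sos, JTNB 34 (2022), §1;
J. Ayoub, EMS Newsl. 91 (2014), Conj. 7; M. Kontsevich, D. Zagier, *Periods* (2001), §1.2.
No definition is introduced (body classes are spelled out as an `∃`).
-/

noncomputable section

open Set MeasureTheory
open Literature.NumberTheory.Transcendental

namespace Summit.KontsevichZagierPeriods.LiouvilleUnfolding.NilradicalCut

open Summit.KontsevichZagierPeriods.LiouvilleUnfolding.PiLocalKernelPosition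
open Summit.KontsevichZagierPeriods.KernelForm.LocaliseAtValuePrime (stub_boundedDecomposition)
open Summit.KontsevichZagierPeriods.KontsevichZagierPeriods.Theses.LiouvilleUnfolding (AyoubPiLocalKernel)

/-! ## Bounded decomposition in `P` and packing -/

/-- Every formal period is `⟦A⟧ − ⟦B⟧` for two BOUNDED volume forms of one dimension `k + 1`, and then
`evalP x = vol A − vol B` (bounded decomposition `stub_boundedDecomposition` + soundness). [folklore] -/
theorem exists_isBounded_sub_eq (x : KZ.FormalPeriodRing) :
    ∃ (k : ℕ) (A B : KZ.IntegralRep (k + 1)), Bornology.IsBounded A.domain ∧ Bornology.IsBounded B.domain ∧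
      (∀ z ∈ A.domain, A.integrand z = 1) ∧ (∀ z ∈ B.domain, B.integrand z = 1) ∧
      KZ.toFormalPeriod (KZ.of A) - KZ.toFormalPeriod (KZ.of B) = x ∧ KZ.evalP x = A.value - B.value := by
  obtain ⟨c, rfl⟩ := KZ.toFormalPeriod_surjective x
  obtain ⟨k, A, B, hAb, hBb, hA1, hB1, e⟩ := stub_boundedDecomposition c
  have hx : KZ.toFormalPeriod (KZ.of A) - KZ.toFormalPeriod (KZ.of B) = KZ.toFormalPeriod c := by
    rw [← map_sub, eq_comm, KZ.toFormalPeriod_eq_iff]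
    exact e
  refine ⟨k, A, B, hAb, hBb, hA1, hB1, hx, ?_⟩
  rw [← hx, map_sub, KZ.evalP_toFormalPeriod_of, KZ.evalP_toFormalPeriod_of]

/-- **Packing in `P`**: if `vol B < vol A` for bounded volume forms of one dimension, then `⟦A⟧ − ⟦B⟧` is
a body class of that dimension (Viu-Sos, `KZ.exists_isCompact_of_sub_of_sub_mem_relations`).
[cite: ViuSos2021, §4] -/
theorem exists_body_eq_sub_of_value_lt {m : ℕ} (A B : KZ.IntegralRep m)
    (hAb : Bornology.IsBounded A.domain) (hBb : Bornology.IsBounded B.domain)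
    (hA1 : ∀ z ∈ A.domain, A.integrand z = 1) (hB1 : ∀ z ∈ B.domain, B.integrand z = 1)
    (hlt : B.value < A.value) :
    ∃ K : KZ.IntegralRep m, IsCompact K.domain ∧ (interior K.domain).Nonempty ∧
      (∀ z ∈ K.domain, K.integrand z = 1) ∧
      KZ.toFormalPeriod (KZ.of K) = KZ.toFormalPeriod (KZ.of A) - KZ.toFormalPeriod (KZ.of B) := by
  obtain ⟨K, hKc, hKi, hK1, hK⟩ := KZ.exists_isCompact_of_sub_of_sub_mem_relations A B hAb hBb hA1 hB1 hlt
  refine ⟨K, hKc, hKi, hK1, ?_⟩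
  rw [← map_sub, eq_comm, KZ.toFormalPeriod_eq_iff]
  exact hK

/-! ## Positive value ⇔ body class -/

/-- **A formal period of positive value is a body class** (Viu-Sos' Thm. 1.1 in the ring `P`).
[cite: ViuSos2021, Thm. 1.1] -/
theorem exists_body_eq_of_evalP_pos {x : KZ.FormalPeriodRing} (hx : 0 < KZ.evalP x) :
    ∃ (m : ℕ) (K : KZ.IntegralRep m), IsCompact K.domain ∧ (interior K.domain).Nonempty ∧
      (∀ z ∈ K.domain, K.integrand z = 1) ∧ KZ.toFormalPeriod (KZ.of K) = x := by
  obtain ⟨k, A, B, hAb, hBb, hA1, hB1, hxe, hv⟩ := exists_isBounded_sub_eq x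
  obtain ⟨K, hKc, hKi, hK1, hK⟩ :=
    exists_body_eq_sub_of_value_lt A B hAb hBb hA1 hB1 (by linarith)
  exact ⟨k + 1, K, hKc, hKi, hK1, hK.trans hxe⟩

/-- A body class has positive value (`vol K > 0` for `K` compact of non-empty interior). [folklore] -/
theorem evalP_pos_of_body {m : ℕ} (K : KZ.IntegralRep m) (hKc : IsCompact K.domain)
    (hKi : (interior K.domain).Nonempty) (hK1 : ∀ z ∈ K.domain, K.integrand z = 1) :
    0 < KZ.evalP (KZ.toFormalPeriod (KZ.of K)) := by
  rw [KZ.evalP_toFormalPeriod_of]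
  exact KZ.IntegralRep.value_pos_of_integrand_eq_one K hKc hKi hK1

/-- **Positivity of a formal period is decided by the moves**: `0 < evalP x` iff `x` is the class of a
compact volume form of non-empty interior. [cite: ViuSos2021, Thm. 1.1] -/
theorem evalP_pos_iff_exists_body (x : KZ.FormalPeriodRing) :
    0 < KZ.evalP x ↔ ∃ (m : ℕ) (K : KZ.IntegralRep m), IsCompact K.domain ∧ (interior K.domain).Nonempty ∧
      (∀ z ∈ K.domain, K.integrand z = 1) ∧ KZ.toFormalPeriod (KZ.of K) = x := by
  refine ⟨exists_body_eq_of_evalP_pos, ?_⟩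
  rintro ⟨m, K, hKc, hKi, hK1, rfl⟩
  exact evalP_pos_of_body K hKc hKi hK1

/-- **The value-kernel without real numbers**: `evalP x = 0` iff neither `x` nor `−x` is a body class.
[folklore] -/
theorem evalP_eq_zero_iff_not_body (x : KZ.FormalPeriodRing) :
    KZ.evalP x = 0 ↔
      (¬ ∃ (m : ℕ) (K : KZ.IntegralRep m), IsCompact K.domain ∧ (interior K.domain).Nonempty ∧
          (∀ z ∈ K.domain, K.integrand z = 1) ∧ KZ.toFormalPeriod (KZ.of K) = x) ∧
        ¬ ∃ (m : ℕ) (K : KZ.IntegralRep m), IsCompact K.domain ∧ (interior K.domain).Nonempty ∧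
          (∀ z ∈ K.domain, K.integrand z = 1) ∧ KZ.toFormalPeriod (KZ.of K) = -x := by
  rw [← evalP_pos_iff_exists_body, ← evalP_pos_iff_exists_body, map_neg]
  constructor
  · intro h
    rw [h, neg_zero]
    exact ⟨lt_irrefl 0, lt_irrefl 0⟩
  · rintro ⟨h₁, h₂⟩
    rcases lt_trichotomy (KZ.evalP x) 0 with h | h | h
    · exact absurd (neg_pos.mpr h) h₂
    · exact h
    · exact absurd h h₁

/-- **The value-kernel as the infinitesimals of the body order** (Archimedean sandwich, no real number in
the statement): `evalP x = 0` iff for every `n : ℕ` both `1 + n x` and `1 − n x` are body classes.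
[folklore] -/
theorem evalP_eq_zero_iff_forall_nat (x : KZ.FormalPeriodRing) :
    KZ.evalP x = 0 ↔ ∀ n : ℕ,
      (∃ (m : ℕ) (K : KZ.IntegralRep m), IsCompact K.domain ∧ (interior K.domain).Nonempty ∧
          (∀ z ∈ K.domain, K.integrand z = 1) ∧ KZ.toFormalPeriod (KZ.of K) = 1 + n * x) ∧
        ∃ (m : ℕ) (K : KZ.IntegralRep m), IsCompact K.domain ∧ (interior K.domain).Nonempty ∧
          (∀ z ∈ K.domain, K.integrand z = 1) ∧ KZ.toFormalPeriod (KZ.of K) = 1 - n * x := by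
  constructor
  · intro h n
    refine ⟨exists_body_eq_of_evalP_pos ?_, exists_body_eq_of_evalP_pos ?_⟩
    · rw [map_add, map_mul, map_one, map_natCast, h, mul_zero, add_zero]; exact one_pos
    · rw [map_sub, map_mul, map_one, map_natCast, h, mul_zero, sub_zero]; exact one_pos
  · intro h
    by_contra hne
    obtain ⟨n, hn⟩ := exists_nat_gt |KZ.evalP x|⁻¹
    obtain ⟨h₁, h₂⟩ := h n
    have e₁ := (evalP_pos_iff_exists_body _).mpr h₁
    have e₂ := (evalP_pos_iff_exists_body _).mpr h₂
    rw [map_add, map_mul, map_one, map_natCast] at e₁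
    rw [map_sub, map_mul, map_one, map_natCast] at e₂
    have habs : 0 < |KZ.evalP x| := abs_pos.mpr hne
    have hn1 : 1 < (n : ℝ) * |KZ.evalP x| := by
      have := (inv_lt_iff_one_lt_mul₀ habs).mp hn
      linarith [this]
    rcases le_or_gt 0 (KZ.evalP x) with h0 | h0
    · rw [abs_of_nonneg h0] at hn1; linarith
    · rw [abs_of_neg h0] at hn1; nlinarith

/-! ## Every class is a difference of two bodies -/

/-- A bounded volume form `A` of dimension `k + 1` becomes a body class after adding a bounded volume
form `U` of positive volume: `⟦A⟧ + ⟦U⟧ = ⟦K⟧` with `K ⊂ ℝ^{k+1}` compact of non-empty interior (merge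
`A` with `U`, then pack against the empty representation). [folklore] -/
theorem exists_body_eq_add {k : ℕ} (A U : KZ.IntegralRep (k + 1)) (hAb : Bornology.IsBounded A.domain)
    (hUb : Bornology.IsBounded U.domain) (hA1 : ∀ z ∈ A.domain, A.integrand z = 1)
    (hU1 : ∀ z ∈ U.domain, U.integrand z = 1) (hUv : 0 < U.value) :
    ∃ K : KZ.IntegralRep (k + 1), IsCompact K.domain ∧ (interior K.domain).Nonempty ∧
      (∀ z ∈ K.domain, K.integrand z = 1) ∧
      KZ.toFormalPeriod (KZ.of K) = KZ.toFormalPeriod (KZ.of A) + KZ.toFormalPeriod (KZ.of U) := by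
  have hAv : 0 ≤ A.value := by
    rw [KZ.IntegralRep.value_eq_volume_real A hA1]; exact measureReal_nonneg
  -- merge `A` and `U`
  obtain ⟨M, hMb, hM1, eM⟩ := KZ.exists_merge₂ A U hAb hUb hA1 hU1
  have hMv : M.value = A.value + U.value := by
    have h0 := KZ.relations_le_ker_eval_holds eM
    rw [AddMonoidHom.mem_ker, map_sub, map_add, KZ.eval_of, KZ.eval_of, KZ.eval_of] at h0
    linarith
  -- pack against the empty representation
  obtain ⟨K, hKc, hKi, hK1, hK⟩ := exists_body_eq_sub_of_value_lt M (KZ.IntegralRep.empty (k + 1)) hMb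
    (by simp) hM1 (by simp) (by rw [KZ.IntegralRep.value_empty, hMv]; linarith)
  refine ⟨K, hKc, hKi, hK1, ?_⟩
  rw [hK, KZ.toFormalPeriod_eq_zero_of_mem KZ.IntegralRep.of_empty_mem_relations, sub_zero, ← map_add,
    KZ.toFormalPeriod_eq_iff]
  have : KZ.of M - (KZ.of A + KZ.of U) = -(KZ.of A + KZ.of U - KZ.of M) := by abel
  rw [this]
  exact KZ.relations.neg_mem eM

/-- **Every formal period is a difference of two body classes of one dimension**: `x = ⟦K₁⟧ − ⟦K₂⟧` with
`K₁, K₂ ⊂ ℝ^{k+1}` compact of non-empty interior, integrand `1` (add the unit cube to both bounded volume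
forms of `exists_isBounded_sub_eq`). [cite: CressonViusos2022, §1 p. 326] -/
theorem exists_body_sub_body (x : KZ.FormalPeriodRing) :
    ∃ (k : ℕ) (K₁ K₂ : KZ.IntegralRep (k + 1)), IsCompact K₁.domain ∧ (interior K₁.domain).Nonempty ∧
      IsCompact K₂.domain ∧ (interior K₂.domain).Nonempty ∧
      (∀ z ∈ K₁.domain, K₁.integrand z = 1) ∧ (∀ z ∈ K₂.domain, K₂.integrand z = 1) ∧
      x = KZ.toFormalPeriod (KZ.of K₁) - KZ.toFormalPeriod (KZ.of K₂) ∧ K₁.value - K₂.value = KZ.evalP x := by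
  obtain ⟨k, A, B, hAb, hBb, hA1, hB1, hxe, hv⟩ := exists_isBounded_sub_eq x
  -- the unit cube `U` of dimension `k + 1`: bounded, integrand `1`, volume `1`
  obtain ⟨U, hUd, hUi⟩ := KZ.exists_oneRep (KZ.isSemialgebraic_cube (n := k + 1))
    (by rw [KZ.volume_cube]; exact ENNReal.one_ne_top)
  have hUb : Bornology.IsBounded U.domain := by rw [hUd]; exact KZ.isCompact_cube.isBounded
  have hU1 : ∀ z ∈ U.domain, U.integrand z = 1 := fun z _ => by rw [hUi]
  have hUv : 0 < U.value := by
    rw [KZ.IntegralRep.value_eq_volume_real U hU1, hUd, KZ.volume_real_cube]; exact one_pos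
  obtain ⟨K₁, h₁c, h₁i, h₁1, h₁⟩ := exists_body_eq_add A U hAb hUb hA1 hU1 hUv
  obtain ⟨K₂, h₂c, h₂i, h₂1, h₂⟩ := exists_body_eq_add B U hBb hUb hB1 hU1 hUv
  have hx : x = KZ.toFormalPeriod (KZ.of K₁) - KZ.toFormalPeriod (KZ.of K₂) := by
    rw [h₁, h₂, ← hxe]; ring
  refine ⟨k, K₁, K₂, h₁c, h₁i, h₂c, h₂i, h₁1, h₂1, hx, ?_⟩
  rw [hx, map_sub, KZ.evalP_toFormalPeriod_of, KZ.evalP_toFormalPeriod_of]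

/-! ## The volume form of the crux -/

/-- **Registered stub `ayoubPiLocalKernel_iff_volumeForm` — the crux is the `[π]`-local volume
conjecture.** Item 0541 holds iff for any two compact `ℚ`-semialgebraic bodies `K₁, K₂ ⊂ ℝ^d` of
non-empty interior and EQUAL VOLUME some disc thickening makes them move-equivalent:
`ϖ ^ N · (⟦K₁⟧ − ⟦K₂⟧) = 0` in `P`. (`→`: the difference has value `0`; `←`: every class of value `0` is a
difference of two bodies of one dimension, `exists_body_sub_body`.) The exponent-`0` statement is
Cresson–Viu-Sos' volume conjecture, equivalent to the summit
(`KZ.kzPeriodConjecture'_iff_volumeConjectureCompact_holds`). [cite: CressonViusos2022, §1 p. 326 Conjecture] -/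
theorem ayoubPiLocalKernel_iff_volumeForm : AyoubPiLocalKernel ↔ ∀ (d : ℕ) (K₁ K₂ : KZ.IntegralRep d), IsCompact K₁.domain → (interior K₁.domain).Nonempty → IsCompact K₂.domain → (interior K₂.domain).Nonempty → (∀ x ∈ K₁.domain, K₁.integrand x = 1) → (∀ x ∈ K₂.domain, K₂.integrand x = 1) → K₁.value = K₂.value → ∃ N : ℕ, KZ.toFormalPeriod (KZ.of KZ.piRep) ^ N * (KZ.toFormalPeriod (KZ.of K₁) - KZ.toFormalPeriod (KZ.of K₂)) = 0 := by
  rw [ayoubPiLocalKernel_iff_piLocalKernel, piLocalKernel_iff_forall_evalP]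
  constructor
  · intro h d K₁ K₂ _ _ _ _ _ _ hv
    apply h
    rw [map_sub, KZ.evalP_toFormalPeriod_of, KZ.evalP_toFormalPeriod_of, hv, sub_self]
  · intro h x hx
    obtain ⟨k, K₁, K₂, h₁c, h₁i, h₂c, h₂i, h₁1, h₂1, rfl, hv⟩ := exists_body_sub_body x
    exact h (k + 1) K₁ K₂ h₁c h₁i h₂c h₂i h₁1 h₂1 (by linarith)

/-- **Body trichotomy — the crux says `P = B ∪ −B ∪ Tors_ϖ`.** Item 0541 holds iff every formal period is
a body class, or the negative of one, or killed by a power of the disc class. [folklore] -/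
theorem ayoubPiLocalKernel_iff_trichotomy :
    AyoubPiLocalKernel ↔ ∀ x : KZ.FormalPeriodRing,
      (∃ (m : ℕ) (K : KZ.IntegralRep m), IsCompact K.domain ∧ (interior K.domain).Nonempty ∧
          (∀ z ∈ K.domain, K.integrand z = 1) ∧ KZ.toFormalPeriod (KZ.of K) = x) ∨
        (∃ (m : ℕ) (K : KZ.IntegralRep m), IsCompact K.domain ∧ (interior K.domain).Nonempty ∧
          (∀ z ∈ K.domain, K.integrand z = 1) ∧ KZ.toFormalPeriod (KZ.of K) = -x) ∨
        ∃ N : ℕ, KZ.toFormalPeriod (KZ.of KZ.piRep) ^ N * x = 0 := by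
  rw [ayoubPiLocalKernel_iff_piLocalKernel, piLocalKernel_iff_forall_evalP]
  constructor
  · intro h x
    rcases lt_trichotomy 0 (KZ.evalP x) with hx | hx | hx
    · exact Or.inl (exists_body_eq_of_evalP_pos hx)
    · exact Or.inr (Or.inr (h x hx.symm))
    · exact Or.inr (Or.inl (exists_body_eq_of_evalP_pos (by rw [map_neg]; linarith)))
  · intro h x hx
    rcases h x with hb | hb | hN
    · have := (evalP_pos_iff_exists_body x).mpr hb
      rw [hx] at this
      exact absurd this (lt_irrefl 0)
    · have := (evalP_pos_iff_exists_body (-x)).mpr hb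
      rw [map_neg, hx, neg_zero] at this
      exact absurd this (lt_irrefl 0)
    · exact hN

/-- **The summit says `P = B ∪ −B ∪ {0}`**: the Kontsevich–Zagier period conjecture (for this calculus)
holds iff every non-zero formal period is, up to sign, the class of a compact volume form — the ring form
of Cresson–Viu-Sos' "Conjecture 1 ⇔ volume conjecture". [cite: CressonViusos2022, §1 p. 326] -/
theorem summit_iff_body_trichotomy :
    KontsevichZagierPeriods ↔ ∀ x : KZ.FormalPeriodRing, x = 0 ∨
      (∃ (m : ℕ) (K : KZ.IntegralRep m), IsCompact K.domain ∧ (interior K.domain).Nonempty ∧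
          (∀ z ∈ K.domain, K.integrand z = 1) ∧ KZ.toFormalPeriod (KZ.of K) = x) ∨
        ∃ (m : ℕ) (K : KZ.IntegralRep m), IsCompact K.domain ∧ (interior K.domain).Nonempty ∧
          (∀ z ∈ K.domain, K.integrand z = 1) ∧ KZ.toFormalPeriod (KZ.of K) = -x := by
  refine Iff.trans (kzKernelConjecture_iff_isRational : KZKernelConjecture ↔ KontsevichZagierPeriods).symm ?_
  constructor
  · intro h x
    rcases lt_trichotomy 0 (KZ.evalP x) with hx | hx | hx
    · exact Or.inr (Or.inl (exists_body_eq_of_evalP_pos hx))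
    · refine Or.inl ?_
      obtain ⟨c, rfl⟩ := KZ.toFormalPeriod_surjective x
      exact KZ.toFormalPeriod_eq_zero_of_mem (h c hx.symm)
    · exact Or.inr (Or.inr (exists_body_eq_of_evalP_pos (by rw [map_neg]; linarith)))
  · intro h c hc
    rw [← KZ.toFormalPeriod_eq_zero_iff]
    rcases h (KZ.toFormalPeriod c) with h0 | hb | hb
    · exact h0
    · have := (evalP_pos_iff_exists_body _).mpr hb
      rw [KZ.evalP_toFormalPeriod, hc] at this
      exact absurd this (lt_irrefl 0)
    · have := (evalP_pos_iff_exists_body _).mpr hb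
      rw [map_neg, KZ.evalP_toFormalPeriod, hc, neg_zero] at this
      exact absurd this (lt_irrefl 0)

/-- **Volume form of the transcendence stub (N) of the line**: `stub_nilLocalKernel` holds iff for any two
compact bodies of one dimension and equal volume, `⟦K₁⟧ − ⟦K₂⟧` is `ϖ`-locally nilpotent. [folklore] -/
theorem nilLocalKernel_iff_volumeForm :
    (∀ x : KZ.FormalPeriodRing, KZ.evalP x = 0 →
        ∃ N k : ℕ, KZ.toFormalPeriod (KZ.of KZ.piRep) ^ N * x ^ (k + 1) = 0) ↔
      ∀ (d : ℕ) (K₁ K₂ : KZ.IntegralRep d), IsCompact K₁.domain → (interior K₁.domain).Nonempty →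
        IsCompact K₂.domain → (interior K₂.domain).Nonempty →
        (∀ x ∈ K₁.domain, K₁.integrand x = 1) → (∀ x ∈ K₂.domain, K₂.integrand x = 1) →
        K₁.value = K₂.value →
        ∃ N k : ℕ, KZ.toFormalPeriod (KZ.of KZ.piRep) ^ N *
          (KZ.toFormalPeriod (KZ.of K₁) - KZ.toFormalPeriod (KZ.of K₂)) ^ (k + 1) = 0 := by
  constructor
  · intro h d K₁ K₂ _ _ _ _ _ _ hv
    apply h
    rw [map_sub, KZ.evalP_toFormalPeriod_of, KZ.evalP_toFormalPeriod_of, hv, sub_self]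
  · intro h x hx
    obtain ⟨k, K₁, K₂, h₁c, h₁i, h₂c, h₂i, h₁1, h₂1, rfl, hv⟩ := exists_body_sub_body x
    exact h (k + 1) K₁ K₂ h₁c h₁i h₂c h₂i h₁1 h₂1 (by linarith)

/-- **Kill shape, volume form**: item 0541 FAILS iff there are two compact `ℚ`-semialgebraic bodies of one
dimension, of non-empty interior and equal volume, that remain move-inequivalent after every disc
thickening. (No such pair is known; each one also refutes the Kontsevich–Zagier conjecture.) [folklore] -/
theorem not_ayoubPiLocalKernel_iff_exists_bodies :
    ¬ AyoubPiLocalKernel ↔ ∃ (d : ℕ) (K₁ K₂ : KZ.IntegralRep d), IsCompact K₁.domain ∧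
      (interior K₁.domain).Nonempty ∧ IsCompact K₂.domain ∧ (interior K₂.domain).Nonempty ∧
      (∀ x ∈ K₁.domain, K₁.integrand x = 1) ∧ (∀ x ∈ K₂.domain, K₂.integrand x = 1) ∧
      K₁.value = K₂.value ∧
      ∀ N : ℕ, KZ.toFormalPeriod (KZ.of KZ.piRep) ^ N *
        (KZ.toFormalPeriod (KZ.of K₁) - KZ.toFormalPeriod (KZ.of K₂)) ≠ 0 := by
  rw [ayoubPiLocalKernel_iff_volumeForm]
  push Not
  rfl

end Summit.KontsevichZagierPeriods.LiouvilleUnfolding.NilradicalCut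

end
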